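import Summits.Ventures.Crystal3D.Theorems.StickyWulffConstantPolycrystalWulffBoundTwinCapsChimera
import Summits.Ventures.Crystal3D.Theorems.StickyWulffConstantPolycrystalWulffBoundMinkowskiUpper
import Summits.Ventures.Crystal3D.Theorems.StickyWulffConstantPolycrystalWulffBoundPolyClosure
import Summits.Ventures.Crystal3D.Theorems.StickyWulffConstantPolycrystalWulffBoundSeparated

/-!
# `PolycrystalWulffBound`, line `PolyDensity`: the rung `rung_twinCaps` — a polyhedral grain with
# finitely many separated TWIN CAPS ABOUT DIFFERENT AXES satisfies the polycrystal Wulff bound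
# (FREE energy alone; crux `stmt-Ventures-19482`)

Route `StickyWulffConstant` of the venture `Summits/Ventures/Crystal3D`, second prover lane (poly-p2,
gen 12).  THE FIRST UNIFORM MULTI-AXIS RUNG WITH ZERO WALL BUDGET.  Data: a polyhedral set `E` of finite
volume; `k` cap planes `⟪x, m i⟫ = t i`; the parent grain `E ∩ {∀ i, ⟪x, m i⟫ < t i}` with frame `A₀`
and the caps `E ∩ {t i < ⟪x, m i⟫}` with frames `B i`, each co-axial with the parent ABOUT ITS OWN AXIS
(`Ax (m i) A₀ (B i)`: the cap is the parent's lattice or its coherent twin across the basal plane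
`⊥ m i`; the `m i` are typically several different `⟨111⟩` axes of `A₀`); the caps pairwise
`δ`-separated.  Conclusion: the FREE energy `Fr` of this texture (every wall is a coherent basal twin
plane, charge-free in the crux's law) is at least `6·2^{1/3}(√2·Vol)^{2/3}` — for EVERY container `E`,
every number of caps, every depth (a cap through the centre, `t i = 0` on the Wulff crystal, is the
centred twin bicrystal = an equality case).  This is the planner's residual (P-R3) «compound basal caps
about different axes» (ROUTE §86(68) BK, §86(73) BP; census P-HYBRID-g11 §9: true on `W`, +0.0184·d per
cap, no rung in the slide/relabel family because the budget is 0).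
Proof (Brunn–Minkowski route of `rung_basalLamellar`, with a NEW lower bound): for small `r` the chimera
neighbourhood `C_r = ⋃_f (G_f + r·W(A_f))` has `(|E'|^{1/3} + r·32^{1/3})³ ≤ |C_r|`
(`twinCaps_chimera_lower`: PIECEWISE Brunn–Minkowski with proportional quantile targets — no common flag
is needed because each cap is sorted along its own axis and the parent's target stays below every cap's
quantile plane) and `|C_r| ≤ |E'| + r·(Fr + ε)` (`volume_chimera_texture_le`); expand and let `ε → 0`.
`rung_twinCaps_texture` is the crux's `Tex`/`En` form (walls nonnegative, no charge used).
WHAT THIS IS NOT: a registered stub; caps on caps / lamellar stacks on facets / charged walls are not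
here; the crux is not claimed.
-/

noncomputable section

open scoped BigOperators InnerProductSpace ENNReal Pointwise
open MeasureTheory Filter Set

namespace Summit.Ventures.Crystal3D.Cruxes.PolycrystalWulffBound.PolyDensity

open Summit.Ventures.Crystal3D.Theorems
open Summit.Ventures.Crystal3D.Cruxes.TextureLiminf.TexShadow (per polytope E3)
open Literature.MathematicalPhysics.StatisticalMechanics (fccStacking barlowStacking IsHaggSeq perimeter)

/-- **Rung `rung_twinCaps`** (uniform, multi-axis, zero wall budget): a polyhedral set `E` of finite
volume, split into the parent `E ∩ {∀ i, ⟪x, m i⟫ < t i}` (frame `A₀`) and the pairwise `δ`-separated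
caps `E ∩ {t i < ⟪x, m i⟫}` (frames `B i` with `Ax (m i) A₀ (B i)`), has FREE energy
`Fr ≥ 6·2^{1/3}(√2·Vol)^{2/3}`. -/
theorem rung_twinCaps : let Λ : Set (EuclideanSpace ℝ (Fin 3)) := Literature.MathematicalPhysics.StatisticalMechanics.fccStacking 1 (Real.sqrt (2 / 3)); let Brl : (ℤ → ℤ) → Set (EuclideanSpace ℝ (Fin 3)) := Literature.MathematicalPhysics.StatisticalMechanics.barlowStacking 1 (Real.sqrt (2 / 3)); let Ax : EuclideanSpace ℝ (Fin 3) → (EuclideanSpace ℝ (Fin 3) ≃ₗᵢ[ℝ] EuclideanSpace ℝ (Fin 3)) → (EuclideanSpace ℝ (Fin 3) ≃ₗᵢ[ℝ] EuclideanSpace ℝ (Fin 3)) → Prop := fun m A B => ∃ (L : EuclideanSpace ℝ (Fin 3) ≃ₗᵢ[ℝ] EuclideanSpace ℝ (Fin 3)) (s₁ s₂ : EuclideanSpace ℝ (Fin 3)) (σ σ' : ℤ → ℤ), Literature.MathematicalPhysics.StatisticalMechanics.IsHaggSeq σ ∧ Literature.MathematicalPhysics.StatisticalMechanics.IsHaggSeq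 σ' ∧ L (EuclideanSpace.single (2 : Fin 3) (1 : ℝ)) = m ∧ A '' Λ ⊆ (fun q => L q + s₁) '' Brl σ ∧ B '' Λ ⊆ (fun q => L q + s₂) '' Brl σ'; let Φ : EuclideanSpace ℝ (Fin 3) → ℝ := fun ν => Real.sqrt 2 / 4 * ∑ᶠ w ∈ {w ∈ Λ | ‖w‖ = 1}, |⟪w, ν⟫_ℝ|; let Per : Set (EuclideanSpace ℝ (Fin 3)) → Set (EuclideanSpace ℝ (Fin 3)) → ℝ := fun K S => (⨆ (ξ : EuclideanSpace ℝ (Fin 3) → EuclideanSpace ℝ (Fin 3)) (_ : ContDiff ℝ 1 ξ ∧ HasCompactSupport ξ ∧ ∀ z, ξ z ∈ K), ENNReal.ofReal (∫ z in S, Literature.MathematicalPhysics.StatisticalMechanics.fieldDivergence ξ z)).toReal; let ι : Set (EuclideanSpace ℝ (Fin 3)) → Set (EuclideanSpace ℝ (Fin 3)) → Set (EuclideanSpace ℝ (Fin 3)) → ℝ := fun K S₁ S₂ => (Per K S₁ + Per K S₂ - Per K (S₁ ∪ S₂)) / 2; let W : (EuclideanSpace ℝ (Fin 3) ≃ₗᵢ[ℝ]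 EuclideanSpace ℝ (Fin 3)) → Set (EuclideanSpace ℝ (Fin 3)) := fun A => {y | ∀ ν : EuclideanSpace ℝ (Fin 3), ⟪y, ν⟫_ℝ ≤ Φ (A.symm ν)}; let Vol : (n : ℕ) → (Fin n → Set (EuclideanSpace ℝ (Fin 3))) → ℝ := fun n G => (volume (⋃ f : Fin n, G f)).toReal; let Poly : Set (EuclideanSpace ℝ (Fin 3)) → Prop := fun S => ∃ (k : ℕ) (H : Fin k → Finset ((EuclideanSpace ℝ (Fin 3)) × ℝ)), S = ⋃ i, ⋂ p ∈ H i, {x | ⟪p.1, x⟫_ℝ < p.2}; let Fr : (n : ℕ) → (Fin n → Set (EuclideanSpace ℝ (Fin 3))) → (Fin n → (EuclideanSpace ℝ (Fin 3) ≃ₗᵢ[ℝ] EuclideanSpace ℝ (Fin 3))) → ℝ := fun n G A => ∑ f : Fin n, Per (W (A f)) (G f) - ∑ f, ∑ g, (if f = g then 0 else ι (W (A f)) (G f) (G g)); ∀ (E : Set (EuclideanSpace ℝ (Fin 3))), Poly E → volume E < ⊤ → ∀ (k : ℕ) (m : Fin k → EuclideanSpace ℝ (Fin 3)) (t : Fin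 k → ℝ) (A₀ : EuclideanSpace ℝ (Fin 3) ≃ₗᵢ[ℝ] EuclideanSpace ℝ (Fin 3)) (B : Fin k → (EuclideanSpace ℝ (Fin 3) ≃ₗᵢ[ℝ] EuclideanSpace ℝ (Fin 3))), (∀ i, Ax (m i) A₀ (B i)) → ∀ (δ : ℝ), 0 < δ → (∀ i j, i ≠ j → ∀ x ∈ E, ∀ y ∈ E, t i < ⟪x, m i⟫_ℝ → t j < ⟪y, m j⟫_ℝ → δ ≤ dist x y) → 6 * (2 : ℝ) ^ ((1 : ℝ) / 3) * (Real.sqrt 2 * Vol (k + 1) (Matrix.vecCons (E ∩ {x | ∀ i, ⟪x, m i⟫_ℝ < t i}) (fun i => E ∩ {x | t i < ⟪x, m i⟫_ℝ}))) ^ ((2 : ℝ) / 3) ≤ Fr (k + 1) (Matrix.vecCons (E ∩ {x | ∀ i, ⟪x, m i⟫_ℝ < t i}) (fun i => E ∩ {x | t i < ⟪x, m i⟫_ℝ})) (Matrix.vecCons A₀ B) := by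
  intro Λ Brl Ax Φ Per ι W Vol Poly Fr E hE hEv k m t A₀ B hAx δ hδ hsep
  classical
  -- the grains and frames
  set P : Set E3 := E ∩ {x : E3 | ∀ i, ⟪x, m i⟫_ℝ < t i} with hP
  set C : Fin k → Set E3 := fun i => E ∩ {x : E3 | t i < ⟪x, m i⟫_ℝ} with hC
  set G : Fin (k + 1) → Set E3 := Matrix.vecCons P C with hG
  set A : Fin (k + 1) → (E3 ≃ₗᵢ[ℝ] E3) := Matrix.vecCons A₀ B with hA
  show 6 * (2 : ℝ) ^ ((1 : ℝ) / 3) * (Real.sqrt 2 * (volume (⋃ f, G f)).toReal) ^ ((2 : ℝ) / 3) ≤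
    (∑ f, Per (W (A f)) (G f)) - ∑ f, ∑ g, (if f = g then 0 else ι (W (A f)) (G f) (G g))
  rw [← Finset.sum_sub_distrib]
  have hG0 : G 0 = P := by simp [hG]
  have hGs : ∀ i : Fin k, G i.succ = C i := fun i => by simp [hG]
  have hA0 : A 0 = A₀ := by simp [hA]
  have hAs : ∀ i : Fin k, A i.succ = B i := fun i => by simp [hA]
  -- polyhedrality, finiteness, disjointness of the grains
  have hPpoly : ∃ (k' : ℕ) (H : Fin k' → Finset (E3 × ℝ)), P = ⋃ i, polytope (H i) := by
    have hset : {x : E3 | ∀ i, ⟪x, m i⟫_ℝ < t i} =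
        polytope (Finset.univ.image fun i => (m i, t i)) := by
      ext x
      simp only [polytope, mem_setOf_eq, mem_iInter, Finset.mem_image, Finset.mem_univ, true_and]
      constructor
      · rintro h p ⟨i, rfl⟩
        simpa [real_inner_comm] using h i
      · intro h i
        have := h (m i, t i) ⟨i, rfl⟩
        simpa [real_inner_comm] using this
    rw [hP, hset]
    exact poly_inter_polytope hE _
  have hCpoly : ∀ i, ∃ (k' : ℕ) (H : Fin k' → Finset (E3 × ℝ)), C i = ⋃ j, polytope (H j) := by
    intro i
    have hset : {x : E3 | t i < ⟪x, m i⟫_ℝ} = {x : E3 | ⟪x, -m i⟫_ℝ < -t i} := by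
      ext x; simp only [mem_setOf_eq, inner_neg_right, neg_lt_neg_iff]
    show ∃ (k' : ℕ) (H : Fin k' → Finset (E3 × ℝ)), E ∩ {x : E3 | t i < ⟪x, m i⟫_ℝ} = ⋃ j, polytope (H j)
    rw [hset]
    exact poly_inter_halfSpace hE _ _
  have hPolyG : ∀ f, ∃ (k' : ℕ) (H : Fin k' → Finset (E3 × ℝ)), G f = ⋃ i, polytope (H i) := by
    intro f
    induction f using Fin.cases with
    | zero => rw [hG0]; exact hPpoly
    | succ i => rw [hGs]; exact hCpoly i
  have hvolG : ∀ f, volume (G f) < ⊤ := by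
    intro f
    induction f using Fin.cases with
    | zero => rw [hG0]; exact lt_of_le_of_lt (measure_mono inter_subset_left) hEv
    | succ i => rw [hGs]; exact lt_of_le_of_lt (measure_mono inter_subset_left) hEv
  have hPt : ∀ x ∈ P, ∀ i, ⟪x, m i⟫_ℝ < t i := fun x hx i => hx.2 i
  have hCt : ∀ i, ∀ x ∈ C i, t i < ⟪x, m i⟫_ℝ := fun i x hx => hx.2
  have hsepC : ∀ i j, i ≠ j → ∀ x ∈ C i, ∀ y ∈ C j, δ ≤ dist x y :=
    fun i j hij x hx y hy => hsep i j hij x hx.1 y hy.1 hx.2 hy.2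
  have hPC : ∀ i, Disjoint P (C i) := by
    intro i
    rw [Set.disjoint_left]
    intro x hxP hxC
    exact lt_irrefl _ ((hPt x hxP i).trans (hCt i x hxC))
  have hCC : ∀ i j, i ≠ j → Disjoint (C i) (C j) := by
    intro i j hij
    rw [Set.disjoint_left]
    intro x hxi hxj
    have h := hsepC i j hij x hxi x hxj
    rw [dist_self] at h
    exact absurd h (not_le.2 hδ)
  have hdisjG : ∀ f g, f ≠ g → Disjoint (G f) (G g) := by
    intro f g hfg
    induction f using Fin.cases with
    | zero =>
      induction g using Fin.cases with
      | zero => exact absurd rfl hfg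
      | succ j => rw [hG0, hGs]; exact hPC j
    | succ i =>
      induction g using Fin.cases with
      | zero => rw [hG0, hGs]; exact (hPC i).symm
      | succ j =>
        rw [hGs, hGs]
        exact hCC i j fun h => hfg (by rw [h])
  -- bodies
  have hWc : ∀ f, IsCompact (W (A f)) := fun f => isCompact_cruxWulffBody (A f)
  have hWv : ∀ f, Convex ℝ (W (A f)) := fun f => convex_cruxWulffBody (A f)
  have hW0 : ∀ f, (0 : E3) ∈ W (A f) := fun f => zero_mem_cruxWulffBody (A f)
  have hWs : ∀ f, -W (A f) = W (A f) := fun f => neg_cruxWulffBody_eq (A f)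
  -- the free energy is nonnegative (`Fr ≥ √3·Per(E')`)
  have hFr0 : 0 ≤ ∑ f, (Per (W (A f)) (G f) - ∑ g, (if f = g then 0 else ι (W (A f)) (G f) (G g))) := by
    have h := freeEnergy_ge_mul_perimeter G hPolyG hvolG hdisjG (fun f => W (A f)) hWc hWv hW0 hWs
      (Real.sqrt_pos.2 (by norm_num : (0:ℝ) < 3)) (fun f => closedBall_subset_cruxWulffBody (A f))
    exact le_trans (mul_nonneg (Real.sqrt_nonneg 3) ENNReal.toReal_nonneg) h
  set V : ℝ := (volume (⋃ f, G f)).toReal with hV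
  have hV0 : 0 ≤ V := ENNReal.toReal_nonneg
  set F : ℝ := ∑ f, (Per (W (A f)) (G f) - ∑ g, (if f = g then 0 else ι (W (A f)) (G f) (G g))) with hF
  -- `⋃ G f = P ∪ ⋃ C i`; openness; measurability; finiteness
  have hUG : (⋃ f, G f) = P ∪ ⋃ i, C i := by
    ext x
    simp only [mem_iUnion, mem_union]
    rw [Fin.exists_fin_succ, hG0]
    simp only [hGs]
  have hEopen : IsOpen E := by
    obtain ⟨k', H, rfl⟩ := hE
    exact isOpen_iUnion fun i => isOpen_biInter_finset fun q _ =>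
      isOpen_lt (continuous_const.inner continuous_id) continuous_const
  have hPo : IsOpen P := by
    have : {x : E3 | ∀ i, ⟪x, m i⟫_ℝ < t i} = ⋂ i, {x : E3 | ⟪x, m i⟫_ℝ < t i} := by
      ext x; simp only [mem_setOf_eq, mem_iInter]
    rw [hP, this]
    exact hEopen.inter (isOpen_iInter_of_finite fun i =>
      isOpen_lt (continuous_id.inner continuous_const) continuous_const)
  have hCo : ∀ i, IsOpen (C i) := fun i =>
    hEopen.inter (isOpen_lt continuous_const (continuous_id.inner continuous_const))
  have hE'top : volume (⋃ f, G f) ≠ ⊤ := by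
    refine (lt_of_le_of_lt (measure_mono (iUnion_subset fun f => ?_)) hEv).ne
    induction f using Fin.cases with
    | zero => rw [hG0]; exact inter_subset_left
    | succ i => rw [hGs]; exact inter_subset_left
  by_cases hE'0 : volume (⋃ f, G f) = 0
  · -- empty texture: the bound is `0 ≤ Fr`
    have hV00 : V = 0 := by rw [hV, hE'0, ENNReal.toReal_zero]
    rw [hV00, mul_zero, Real.zero_rpow (by norm_num), mul_zero]
    exact hFr0
  -- `E` is bounded, hence so are the chimera neighbourhoods
  have hEbd : Bornology.IsBounded E := by
    obtain ⟨k', H, hEeq⟩ := hE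
    rw [hEeq]
    refine Bornology.isBounded_iUnion.2 fun i => isBounded_hPolyhedron_of_volume_lt_top (H i) ?_
    exact lt_of_le_of_lt (measure_mono (by
      rw [hEeq]; exact subset_iUnion (fun i => ⋂ p ∈ H i, {x : E3 | ⟪p.1, x⟫_ℝ < p.2}) i)) hEv
  -- the chimera neighbourhood of radius `r`
  have key : ∀ ε : ℝ, 0 < ε → 3 * (32 : ℝ) ^ ((3 : ℝ)⁻¹) * (V ^ ((3 : ℝ)⁻¹)) ^ 2 ≤ F + ε := by
    intro ε hε
    obtain ⟨r₀, hr₀, hup⟩ := volume_chimera_texture_le G hPolyG hvolG hdisjG (fun f => W (A f))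
      hWc hWv hW0 hWs hε
    set r : ℝ := min (r₀ / 2) (δ / (2 * (Real.sqrt 5 + 1))) with hr
    have h51 : 0 < 2 * (Real.sqrt 5 + 1) := by positivity
    have hr0 : 0 < r := lt_min (by positivity) (div_pos hδ h51)
    have hrr₀ : r < r₀ := lt_of_le_of_lt (min_le_left _ _) (by linarith)
    have hrδ : r * (2 * (Real.sqrt 5 + 1)) ≤ δ := by
      have h1 : r ≤ δ / (2 * (Real.sqrt 5 + 1)) := min_le_right _ _
      calc r * (2 * (Real.sqrt 5 + 1)) ≤ δ / (2 * (Real.sqrt 5 + 1)) * (2 * (Real.sqrt 5 + 1)) := by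
            gcongr
        _ = δ := div_mul_cancel₀ δ h51.ne'
    set Cr : Set E3 := ⋃ f, ⋃ x ∈ G f, x +ᵥ (r • W (A f)) with hCr
    -- `Cr` is open (a union of translates of the open grains), hence measurable
    have hGo : ∀ f, IsOpen (G f) := by
      intro f
      induction f using Fin.cases with
      | zero => rw [hG0]; exact hPo
      | succ i => rw [hGs]; exact hCo i
    have hCopen : IsOpen Cr := by
      have hCeq : Cr = ⋃ f, ⋃ w ∈ r • W (A f), (fun x => x + w) '' G f := by
        ext y
        simp only [hCr, mem_iUnion, Set.mem_vadd_set, vadd_eq_add, mem_image, exists_prop]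
        constructor
        · rintro ⟨f, x, hx, w, hw, rfl⟩; exact ⟨f, w, hw, x, hx, rfl⟩
        · rintro ⟨f, w, hw, x, hx, rfl⟩; exact ⟨f, x, hx, w, hw, rfl⟩
      rw [hCeq]
      exact isOpen_iUnion fun f => isOpen_biUnion fun w _ => (isOpenMap_add_right w) _ (hGo f)
    have hCm : MeasurableSet Cr := hCopen.measurableSet
    -- `Cr` is bounded, hence of finite volume
    have hCfin : volume Cr ≠ ⊤ := by
      obtain ⟨R₁, hR₁⟩ := hEbd.subset_closedBall 0
      have hGE : ∀ f, G f ⊆ E := by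
        intro f
        induction f using Fin.cases with
        | zero => rw [hG0]; exact inter_subset_left
        | succ i => rw [hGs]; exact inter_subset_left
      have hCsub : Cr ⊆ Metric.closedBall (0 : E3) (R₁ + r * Real.sqrt 5) := by
        intro y hy
        simp only [hCr, mem_iUnion, Set.mem_vadd_set, vadd_eq_add, exists_prop] at hy
        obtain ⟨f, x, hx, w, hw, rfl⟩ := hy
        obtain ⟨w', hw', rfl⟩ := Set.mem_smul_set.1 hw
        have hx' : ‖x‖ ≤ R₁ := mem_closedBall_zero_iff.1 (hR₁ (hGE f hx))
        have hw'' : ‖w'‖ ≤ Real.sqrt 5 :=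
          mem_closedBall_zero_iff.1 (cruxWulffBody_subset_closedBall (A f) hw')
        rw [mem_closedBall_zero_iff]
        calc ‖x + r • w'‖ ≤ ‖x‖ + ‖r • w'‖ := norm_add_le _ _
          _ = ‖x‖ + r * ‖w'‖ := by rw [norm_smul, Real.norm_of_nonneg hr0.le]
          _ ≤ R₁ + r * Real.sqrt 5 := by gcongr
      exact (lt_of_le_of_lt (measure_mono hCsub) measure_closedBall_lt_top).ne
    -- lower bound (piecewise Brunn–Minkowski) and upper bound (Minkowski content)
    have h0' : volume (P ∪ ⋃ i, C i) ≠ 0 := by rwa [← hUG]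
    have htop' : volume (P ∪ ⋃ i, C i) ≠ ⊤ := by rwa [← hUG]
    have hlow := twinCaps_chimera_lower m t A₀ B hAx P C hPo hCo hPt hCt hδ hsepC h0' htop' hr0 hrδ
      (U := Cr)
      (fun x hx w hw => mem_iUnion.2 ⟨0, mem_iUnion₂.2 ⟨x, by rw [hG0]; exact hx,
        Set.mem_vadd_set.2 ⟨r • w, Set.smul_mem_smul_set (by rw [hA0]; exact hw), rfl⟩⟩⟩)
      (fun i x hx w hw => mem_iUnion.2 ⟨i.succ, mem_iUnion₂.2 ⟨x, by rw [hGs]; exact hx,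
        Set.mem_vadd_set.2 ⟨r • w, Set.smul_mem_smul_set (by rw [hAs]; exact hw), rfl⟩⟩⟩)
    rw [← hUG] at hlow
    have hupC : (volume Cr).toReal ≤ V + r * (F + ε) := hup r hr0 hrr₀
    -- to real numbers
    set c : ℝ := (32 : ℝ) ^ ((3 : ℝ)⁻¹) with hc
    have hc0 : 0 ≤ c := by positivity
    have hexp : (((3 : ℕ) : ℝ)⁻¹) = (3 : ℝ)⁻¹ := by norm_num
    have h1 : V ^ ((3 : ℝ)⁻¹) + r * c ≤ (volume Cr).toReal ^ ((3 : ℝ)⁻¹) := by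
      have h := ENNReal.toReal_mono (ENNReal.rpow_ne_top_of_nonneg (by positivity) hCfin) hlow
      rw [ENNReal.toReal_add (ENNReal.rpow_ne_top_of_nonneg (by positivity) hE'top)
          (ENNReal.mul_ne_top ENNReal.ofReal_ne_top (ENNReal.rpow_ne_top_of_nonneg (by positivity)
            ENNReal.ofReal_ne_top)),
        ENNReal.toReal_mul, ENNReal.toReal_ofReal hr0.le, ← ENNReal.toReal_rpow, ← ENNReal.toReal_rpow,
        ← ENNReal.toReal_rpow, ENNReal.toReal_ofReal (by norm_num : (0:ℝ) ≤ 32), hexp] at h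
      exact h
    -- cube: `(V^{1/3} + r c)³ ≤ |Cr| ≤ V + r (F + ε)`
    set x : ℝ := V ^ ((3 : ℝ)⁻¹) with hx
    have hx0 : 0 ≤ x := by positivity
    have hx3 : x ^ 3 = V := by
      rw [hx, show ((3 : ℝ)⁻¹) = ((3 : ℕ) : ℝ)⁻¹ by norm_num]
      exact Real.rpow_inv_natCast_pow hV0 (by norm_num)
    have hC3 : ((volume Cr).toReal ^ ((3 : ℝ)⁻¹)) ^ 3 = (volume Cr).toReal := by
      rw [show ((3 : ℝ)⁻¹) = ((3 : ℕ) : ℝ)⁻¹ by norm_num]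
      exact Real.rpow_inv_natCast_pow ENNReal.toReal_nonneg (by norm_num)
    have h2 : (x + r * c) ^ 3 ≤ V + r * (F + ε) := by
      calc (x + r * c) ^ 3 ≤ ((volume Cr).toReal ^ ((3 : ℝ)⁻¹)) ^ 3 := by
            gcongr
        _ = (volume Cr).toReal := hC3
        _ ≤ V + r * (F + ε) := hupC
    -- drop the higher-order terms and divide by `r`
    have h3 : r * (3 * c * x ^ 2) ≤ r * (F + ε) := by
      nlinarith [hx3, h2, hx0, hc0, hr0.le, mul_nonneg (mul_nonneg hr0.le hc0) (mul_nonneg hr0.le hc0),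
        pow_nonneg (mul_nonneg hr0.le hc0) 3, mul_nonneg hx0 (mul_nonneg (mul_nonneg hr0.le hc0) (mul_nonneg hr0.le hc0))]
    have h4 : 3 * c * x ^ 2 ≤ F + ε := le_of_mul_le_mul_left h3 hr0
    linarith
  rw [wulff_constant_eq hV0]
  exact le_of_forall_pos_le_add key

/-- **Texture form of `rung_twinCaps`** (the crux's own `Tex`/`En`): for the parent-and-caps grain
family of `rung_twinCaps` and ANY wall data `(c, mm)` admitted by the crux's texture predicate `Tex`
(which only contributes `0 ≤ c f g` here: every wall term `(c/2)·ι_{Dsc}(G f, G g)` is nonnegative), the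
crux's energy satisfies `6·2^{1/3}(√2·Vol)^{2/3} ≤ En` — with NO charge used: all walls of this texture
are coherent basal twin planes. -/
theorem rung_twinCaps_texture : let Λ : Set (EuclideanSpace ℝ (Fin 3)) := Literature.MathematicalPhysics.StatisticalMechanics.fccStacking 1 (Real.sqrt (2 / 3)); let Brl : (ℤ → ℤ) → Set (EuclideanSpace ℝ (Fin 3)) := Literature.MathematicalPhysics.StatisticalMechanics.barlowStacking 1 (Real.sqrt (2 / 3)); let Ax : EuclideanSpace ℝ (Fin 3) → (EuclideanSpace ℝ (Fin 3) ≃ₗᵢ[ℝ] EuclideanSpace ℝ (Fin 3)) → (EuclideanSpace ℝ (Fin 3) ≃ₗᵢ[ℝ] EuclideanSpace ℝ (Fin 3)) → Prop := fun m A B => ∃ (L : EuclideanSpace ℝ (Fin 3) ≃ₗᵢ[ℝ] EuclideanSpace ℝ (Fin 3)) (s₁ s₂ : EuclideanSpace ℝ (Fin 3)) (σ σ' : ℤ → ℤ), Literature.MathematicalPhysics.StatisticalMechanics.IsHaggSeq σ ∧ Literature.MathematicalPhysics.StatisticalMechanics.IsHaggSeq σ' ∧ L (EuclideanSpace.single (2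 : Fin 3) (1 : ℝ)) = m ∧ A '' Λ ⊆ (fun q => L q + s₁) '' Brl σ ∧ B '' Λ ⊆ (fun q => L q + s₂) '' Brl σ'; let CoAx : (EuclideanSpace ℝ (Fin 3) ≃ₗᵢ[ℝ] EuclideanSpace ℝ (Fin 3)) → (EuclideanSpace ℝ (Fin 3) ≃ₗᵢ[ℝ] EuclideanSpace ℝ (Fin 3)) → Prop := fun A B => ∃ m, Ax m A B; let Φ : EuclideanSpace ℝ (Fin 3) → ℝ := fun ν => Real.sqrt 2 / 4 * ∑ᶠ w ∈ {w ∈ Λ | ‖w‖ = 1}, |⟪w, ν⟫_ℝ|; let Per : Set (EuclideanSpace ℝ (Fin 3)) → Set (EuclideanSpace ℝ (Fin 3)) → ℝ := fun K S => (⨆ (ξ : EuclideanSpace ℝ (Fin 3) → EuclideanSpace ℝ (Fin 3)) (_ : ContDiff ℝ 1 ξ ∧ HasCompactSupport ξ ∧ ∀ z, ξ z ∈ K), ENNReal.ofReal (∫ z in S, Literature.MathematicalPhysics.StatisticalMechanics.fieldDivergence ξ z)).toReal; let ι : Set (EuclideanSpace ℝ (Fin 3)) → Set (EuclideanSpace ℝ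 (Fin 3)) → Set (EuclideanSpace ℝ (Fin 3)) → ℝ := fun K S₁ S₂ => (Per K S₁ + Per K S₂ - Per K (S₁ ∪ S₂)) / 2; let W : (EuclideanSpace ℝ (Fin 3) ≃ₗᵢ[ℝ] EuclideanSpace ℝ (Fin 3)) → Set (EuclideanSpace ℝ (Fin 3)) := fun A => {y | ∀ ν : EuclideanSpace ℝ (Fin 3), ⟪y, ν⟫_ℝ ≤ Φ (A.symm ν)}; let Dsc : EuclideanSpace ℝ (Fin 3) → Set (EuclideanSpace ℝ (Fin 3)) := fun m => {y | ‖y‖ ≤ 1 ∧ ⟪y, m⟫_ℝ = 0}; let Tex : (n : ℕ) → (Fin n → Set (EuclideanSpace ℝ (Fin 3))) → (Fin n → (EuclideanSpace ℝ (Fin 3) ≃ₗᵢ[ℝ] EuclideanSpace ℝ (Fin 3))) → (Fin n → Fin n → ℝ) → (Fin n → Fin n → EuclideanSpace ℝ (Fin 3)) → Prop := fun n G A c m => (∀ f : Fin n, Literature.MathematicalPhysics.StatisticalMechanics.HasFinitePerimeter (G f) ∧ volume (G f) < ⊤) ∧ (∀ f g, f ≠ g → Disjoint (G f) (G g)) ∧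 (∀ f g, f ≠ g → 0 ≤ c f g) ∧ (∀ f g, f ≠ g → ¬ CoAx (A f) (A g) → m f g = 0 ∧ 1 ≤ c f g) ∧ (∀ f g, f ≠ g → CoAx (A f) (A g) → A f '' Λ ≠ A g '' Λ → Ax (m f g) (A f) (A g) ∧ 1 / 2 ≤ c f g); let En : (n : ℕ) → (Fin n → Set (EuclideanSpace ℝ (Fin 3))) → (Fin n → (EuclideanSpace ℝ (Fin 3) ≃ₗᵢ[ℝ] EuclideanSpace ℝ (Fin 3))) → (Fin n → Fin n → ℝ) → (Fin n → Fin n → EuclideanSpace ℝ (Fin 3)) → ℝ := fun n G A c m => ∑ f : Fin n, Per (W (A f)) (G f) - ∑ f, ∑ g, (if f = g then 0 else ι (W (A f)) (G f) (G g)) + ∑ f, ∑ g, (if f = g then 0 else c f g / 2 * ι (Dsc (m f g)) (G f) (G g)); let Vol : (n : ℕ) → (Fin n → Set (EuclideanSpace ℝ (Fin 3))) → ℝ := fun n G => (volume (⋃ f : Fin n, G f)).toReal; let Poly : Set (EuclideanSpace ℝ (Fin 3)) → Prop := fun S => ∃ (k : ℕ) (H : Fin k → Finset ((EuclideanSpace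 ℝ (Fin 3)) × ℝ)), S = ⋃ i, ⋂ p ∈ H i, {x | ⟪p.1, x⟫_ℝ < p.2}; ∀ (E : Set (EuclideanSpace ℝ (Fin 3))), Poly E → volume E < ⊤ → ∀ (k : ℕ) (m : Fin k → EuclideanSpace ℝ (Fin 3)) (t : Fin k → ℝ) (A₀ : EuclideanSpace ℝ (Fin 3) ≃ₗᵢ[ℝ] EuclideanSpace ℝ (Fin 3)) (B : Fin k → (EuclideanSpace ℝ (Fin 3) ≃ₗᵢ[ℝ] EuclideanSpace ℝ (Fin 3))), (∀ i, Ax (m i) A₀ (B i)) → ∀ (δ : ℝ), 0 < δ → (∀ i j, i ≠ j → ∀ x ∈ E, ∀ y ∈ E, t i < ⟪x, m i⟫_ℝ → t j < ⟪y, m j⟫_ℝ → δ ≤ dist x y) → ∀ (c : Fin (k + 1) → Fin (k + 1) → ℝ) (mm : Fin (k + 1) → Fin (k + 1) → EuclideanSpace ℝ (Fin 3)), Tex (k + 1) (Matrix.vecCons (E ∩ {x | ∀ i, ⟪x, m i⟫_ℝ < t i}) (fun i => E ∩ {x | t i < ⟪x, m i⟫_ℝ})) (Matrix.vecCons A₀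 B) c mm → 6 * (2 : ℝ) ^ ((1 : ℝ) / 3) * (Real.sqrt 2 * Vol (k + 1) (Matrix.vecCons (E ∩ {x | ∀ i, ⟪x, m i⟫_ℝ < t i}) (fun i => E ∩ {x | t i < ⟪x, m i⟫_ℝ}))) ^ ((2 : ℝ) / 3) ≤ En (k + 1) (Matrix.vecCons (E ∩ {x | ∀ i, ⟪x, m i⟫_ℝ < t i}) (fun i => E ∩ {x | t i < ⟪x, m i⟫_ℝ})) (Matrix.vecCons A₀ B) c mm := by
  intro Λ Brl Ax CoAx Φ Per ι W Dsc Tex En Vol Poly E hE hEv k m t A₀ B hAx δ hδ hsep c mm hTex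
  classical
  obtain ⟨hfin, hdisjG, hc0, -, -⟩ := hTex
  set G : Fin (k + 1) → Set E3 :=
    Matrix.vecCons (E ∩ {x : E3 | ∀ i, ⟪x, m i⟫_ℝ < t i}) (fun i => E ∩ {x : E3 | t i < ⟪x, m i⟫_ℝ})
    with hG
  set A : Fin (k + 1) → (E3 ≃ₗᵢ[ℝ] E3) := Matrix.vecCons A₀ B with hA
  have hFr := rung_twinCaps E hE hEv k m t A₀ B hAx δ hδ hsep
  -- the free part is bounded by the rung; the wall part is nonnegative
  have hvol : ∀ f, volume (G f) < ⊤ := fun f => (hfin f).2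
  have hGpoly : ∀ f, ∃ (k' : ℕ) (H : Fin k' → Finset (E3 × ℝ)), G f = ⋃ i, polytope (H i) := by
    intro f
    induction f using Fin.cases with
    | zero =>
      have hset : {x : E3 | ∀ i, ⟪x, m i⟫_ℝ < t i} =
          polytope (Finset.univ.image fun i => (m i, t i)) := by
        ext x
        simp only [polytope, mem_setOf_eq, mem_iInter, Finset.mem_image, Finset.mem_univ, true_and]
        constructor
        · rintro h p ⟨i, rfl⟩
          simpa [real_inner_comm] using h i
        · intro h i
          have := h (m i, t i) ⟨i, rfl⟩
          simpa [real_inner_comm] using this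
      show ∃ (k' : ℕ) (H : Fin k' → Finset (E3 × ℝ)),
        E ∩ {x : E3 | ∀ i, ⟪x, m i⟫_ℝ < t i} = ⋃ i, polytope (H i)
      rw [hset]
      exact poly_inter_polytope hE _
    | succ i =>
      have hset : {x : E3 | t i < ⟪x, m i⟫_ℝ} = {x : E3 | ⟪x, -m i⟫_ℝ < -t i} := by
        ext x; simp only [mem_setOf_eq, inner_neg_right, neg_lt_neg_iff]
      show ∃ (k' : ℕ) (H : Fin k' → Finset (E3 × ℝ)),
        E ∩ {x : E3 | t i < ⟪x, m i⟫_ℝ} = ⋃ j, polytope (H j)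
      rw [hset]
      exact poly_inter_halfSpace hE _ _
  have hDc : ∀ v : E3, IsCompact (Dsc v) := fun v =>
    Metric.isCompact_of_isClosed_isBounded
      ((isClosed_le continuous_norm continuous_const).inter
        (isClosed_eq (continuous_id.inner continuous_const) continuous_const))
      (Metric.isBounded_closedBall.subset (cruxDisc_subset_closedBall v))
  have hwall : 0 ≤ ∑ f, ∑ g, (if f = g then 0 else c f g / 2 * ι (Dsc (mm f g)) (G f) (G g)) := by
    refine Finset.sum_nonneg fun f _ => Finset.sum_nonneg fun g _ => ?_
    split_ifs with hfg
    · exact le_rfl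
    · have h := iota_nonneg_of_poly G hGpoly hvol hdisjG (hDc (mm f g)) (convex_cruxDisc (mm f g))
        (zero_mem_cruxDisc (mm f g)) hfg
      have hι : 0 ≤ ι (Dsc (mm f g)) (G f) (G g) := by
        show 0 ≤ (per (Dsc (mm f g)) (G f) + per (Dsc (mm f g)) (G g) - per (Dsc (mm f g)) (G f ∪ G g)) / 2
        exact div_nonneg h zero_le_two
      exact mul_nonneg (div_nonneg (hc0 f g hfg) zero_le_two) hι
  show 6 * (2 : ℝ) ^ ((1 : ℝ) / 3) * (Real.sqrt 2 * (volume (⋃ f, G f)).toReal) ^ ((2 : ℝ) / 3) ≤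
    (∑ f, Per (W (A f)) (G f)) - (∑ f, ∑ g, (if f = g then 0 else ι (W (A f)) (G f) (G g))) +
      ∑ f, ∑ g, (if f = g then 0 else c f g / 2 * ι (Dsc (mm f g)) (G f) (G g))
  linarith [hFr, hwall]

end Summit.Ventures.Crystal3D.Cruxes.PolycrystalWulffBound.PolyDensity

end
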